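import Mathlib

/-!
# Comb lemma, localisation step 2: globalising the local map in adapted coordinates

From a map `T : E × ℝ → E × ℝ`, `C¹` on a ball around its fixed point `0`, with derivative
`L = S ⊕ μ` at `0` (`‖S‖ < 1 < μ`) and with the `t`-axis invariant (`(T (0, t)).1 = 0`: adapted
coordinates, the axis is the local unstable manifold), we build `T' = L + (T - L) ∘ π` with `π`
the coordinatewise retraction onto the closed ball of radius `r` (sup norm), which agrees with `T`
on that ball, is continuous, and satisfies the tube hypotheses (H1)–(H3) of the abstract comb
lemma with `λ = ‖S‖ + η`, `δ = η`, expansion `μ - η`, and ANY prescribed cone aperture `κ` on a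
thin enough tube (the thinness uses the uniform continuity of `DT` near the compact axis
segment). Mean value inequalities only; `E` is any real normed space.
-/

set_option linter.dupNamespace false

namespace Summit.FinalStateConjecture.FinalStateConjecture.Theorems.LaminatedThreshold.Comb

open Set Function Filter Topology Metric

variable {E : Type*} [NormedAddCommGroup E] [NormedSpace ℝ E]

/-- The vertical derivative of the first component vanishes along an invariant axis. [folklore] -/
theorem fderiv_vertical_fst_eq_zero {T : E × ℝ → E × ℝ} {r₀ : ℝ}
    (hTC1 : ContDiffOn ℝ 1 T (ball 0 r₀)) (haxis : ∀ t : ℝ, |t| < r₀ → (T ((0 : E), t)).1 = 0)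
    {s : ℝ} (hs : |s| < r₀) : ((fderiv ℝ T ((0 : E), s)) ((0 : E), (1 : ℝ))).1 = 0 := by
  have hmem : ((0 : E), s) ∈ ball (0 : E × ℝ) r₀ := by
    rw [mem_ball_zero_iff, Prod.norm_def]; simpa using hs
  have hdiff : DifferentiableAt ℝ T ((0 : E), s) :=
    (hTC1.differentiableOn one_ne_zero _ hmem).differentiableAt (isOpen_ball.mem_nhds hmem)
  have h1 : HasDerivAt (fun u : ℝ ↦ (T ((0 : E), u)).1)
      ((fderiv ℝ T ((0 : E), s)) ((0 : E), (1 : ℝ))).1 s := by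
    have hc : HasDerivAt (fun u : ℝ ↦ (((0 : E), u) : E × ℝ)) ((0 : E), (1 : ℝ)) s :=
      (hasDerivAt_const s (0 : E)).prodMk (hasDerivAt_id s)
    exact (hdiff.hasFDerivAt.comp_hasDerivAt s hc).fst
  have h2 : HasDerivAt (fun u : ℝ ↦ (T ((0 : E), u)).1) (0 : E) s := by
    have hev : (fun u : ℝ ↦ (T ((0 : E), u)).1) =ᶠ[𝓝 s] fun _ ↦ (0 : E) := by
      have : Iio r₀ ∩ Ioi (-r₀) ∈ 𝓝 s :=
        inter_mem (Iio_mem_nhds (abs_lt.1 hs).2) (Ioi_mem_nhds (abs_lt.1 hs).1)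
      filter_upwards [this] with u hu
      exact haxis u (abs_lt.2 ⟨hu.2, hu.1⟩)
    exact (hasDerivAt_const s (0 : E)).congr_of_eventuallyEq hev
  exact h1.unique h2

/-- Thin tubes: near the compact axis segment `{0} × [-r, r]` the derivative `DT` is uniformly
close to its values on the axis. [folklore] -/
theorem exists_thin_tube {T : E × ℝ → E × ℝ} {r₀ r : ℝ} (hr₀ : 0 < r₀) (hr : r < r₀)
    (hTC1 : ContDiffOn ℝ 1 T (ball 0 r₀)) {ω₀ : ℝ} (hω₀ : 0 < ω₀) :
    ∃ ρ' : ℝ, 0 < ρ' ∧ ∀ (x : E) (s : ℝ), ‖x‖ ≤ ρ' → s ∈ Icc (-r) r →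
      ‖fderiv ℝ T (x, s) - fderiv ℝ T ((0 : E), s)‖ < ω₀ := by
  have hDcont : ContinuousOn (fderiv ℝ T) (ball (0 : E × ℝ) r₀) :=
    hTC1.continuousOn_fderiv_of_isOpen isOpen_ball le_rfl
  have hcont : ContinuousOn (fun x : E ↦ fun s : ℝ ↦ fderiv ℝ T (x, s)).uncurry
      (ball (0 : E) r₀ ×ˢ Icc (-r) r) := by
    have heq : (fun x : E ↦ fun s : ℝ ↦ fderiv ℝ T (x, s)).uncurry = fderiv ℝ T := by
      funext p; rfl
    rw [heq]
    refine hDcont.mono fun p hp ↦ ?_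
    rw [mem_ball_zero_iff, Prod.norm_def, max_lt_iff]
    refine ⟨mem_ball_zero_iff.1 hp.1, ?_⟩
    rw [Real.norm_eq_abs]
    have h2 : p.2 ∈ Icc (-r) r := hp.2
    exact lt_of_le_of_lt (abs_le.2 ⟨h2.1, h2.2⟩) hr
  obtain ⟨v, hv, hvu⟩ := IsCompact.mem_uniformity_of_prod (f := fun x : E ↦ fun s : ℝ ↦
    fderiv ℝ T (x, s)) isCompact_Icc hcont (mem_ball_self hr₀) (Metric.dist_mem_uniformity hω₀)
  obtain ⟨ρ'', hρ'', hsub⟩ := Metric.mem_nhdsWithin_iff.1 hv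
  refine ⟨min (ρ'' / 2) (r₀ / 2), by positivity, fun x s hx hs ↦ ?_⟩
  have hxv : x ∈ v := hsub ⟨mem_ball_zero_iff.2 (by linarith [min_le_left (ρ'' / 2) (r₀ / 2)]),
    mem_ball_zero_iff.2 (by linarith [min_le_right (ρ'' / 2) (r₀ / 2)])⟩
  have := hvu x hxv s hs
  simpa [dist_eq_norm] using this

/-- **Globalisation.** [folklore] -/
theorem exists_globalisation : ∀ {E : Type*} [NormedAddCommGroup E] [NormedSpace ℝ E] {T : E × ℝ → E × ℝ} {S : E →L[ℝ] E} {μ r₀ η : ℝ}, T 0 = 0 → 0 < r₀ → ContDiffOn ℝ 1 T (Metric.ball 0 r₀) → HasFDerivAt T ((S.comp (ContinuousLinearMap.fst ℝ E ℝ)).prod (μ • ContinuousLinearMap.snd ℝ E ℝ)) 0 → 1 < μ → (∀ t : ℝ, |t| < r₀ → (T ((0 : E), t)).1 = 0) → 0 < η → η ≤ (1 - ‖S‖) / 2 → ∃ r : ℝ, 0 < r ∧ r < r₀ ∧ ∃ T' : E × ℝ → E × ℝ, Continuous T' ∧ (∀ p : E × ℝ, ‖p‖ ≤ r → T' p = T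 p) ∧ (∀ p : E × ℝ, ‖p.1‖ ≤ r → ‖(T' p).1‖ ≤ (‖S‖ + η) * ‖p.1‖) ∧ (∀ x : E, ‖x‖ ≤ r → |(T' (x, 0)).2| ≤ η * ‖x‖) ∧ (∀ κ : ℝ, 0 < κ → κ ≤ 1 → ∃ ρ' : ℝ, 0 < ρ' ∧ ρ' ≤ r ∧ ∀ p q : E × ℝ, ‖p.1‖ ≤ ρ' → ‖q.1‖ ≤ ρ' → p.2 ≤ q.2 → ‖q.1 - p.1‖ ≤ κ * (q.2 - p.2) → (μ - η) * (q.2 - p.2) ≤ (T' q).2 - (T' p).2 ∧ ‖(T' q).1 - (T' p).1‖ ≤ κ * ((T' q).2 - (T' p).2)) := by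
  intro E _ _ T S μ r₀ η hT0 hr₀ hTC1 hDT0 hμ haxis hη hη1
  set L : E × ℝ →L[ℝ] E × ℝ := (S.comp (ContinuousLinearMap.fst ℝ E ℝ)).prod
    (μ • ContinuousLinearMap.snd ℝ E ℝ) with hL
  have hLapply : ∀ p : E × ℝ, L p = (S p.1, μ * p.2) := fun p ↦ by
    simp [hL]
  -- the radius `r`: `‖DT - L‖ ≤ η` on the closed ball
  have hDcont : ContinuousOn (fderiv ℝ T) (ball (0 : E × ℝ) r₀) :=
    hTC1.continuousOn_fderiv_of_isOpen isOpen_ball le_rfl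
  have hD0 : fderiv ℝ T 0 = L := hDT0.fderiv
  obtain ⟨r, hr, hrr₀, hDnear⟩ : ∃ r : ℝ, 0 < r ∧ r < r₀ ∧
      ∀ p : E × ℝ, ‖p‖ ≤ r → ‖fderiv ℝ T p - L‖ ≤ η := by
    have hca : ContinuousAt (fderiv ℝ T) 0 :=
      (hDcont 0 (mem_ball_self hr₀)).continuousAt (isOpen_ball.mem_nhds (mem_ball_self hr₀))
    obtain ⟨δ₀, hδ₀, hδ⟩ := Metric.continuousAt_iff.1 hca η hη
    refine ⟨min (δ₀ / 2) (r₀ / 2), by positivity, by linarith [min_le_right (δ₀ / 2) (r₀ / 2)],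
      fun p hp ↦ ?_⟩
    have : dist p 0 < δ₀ := by
      rw [dist_zero_right]; linarith [min_le_left (δ₀ / 2) (r₀ / 2)]
    have h := hδ this
    rw [hD0, dist_eq_norm] at h
    exact h.le
  have hballr : ∀ p : E × ℝ, ‖p‖ ≤ r → p ∈ ball (0 : E × ℝ) r₀ := fun p hp ↦
    mem_ball_zero_iff.2 (lt_of_le_of_lt hp hrr₀)
  have hdiffT : ∀ p : E × ℝ, ‖p‖ ≤ r → DifferentiableAt ℝ T p := fun p hp ↦
    (hTC1.differentiableOn one_ne_zero p (hballr p hp)).differentiableAt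
      (isOpen_ball.mem_nhds (hballr p hp))
  -- the nonlinearity `f = T - L` and its mean value bound on the closed ball
  set f : E × ℝ → E × ℝ := fun p ↦ T p - L p with hf
  have hfderiv : ∀ p : E × ℝ, ‖p‖ ≤ r → HasFDerivAt f (fderiv ℝ T p - L) p := fun p hp ↦
    (hdiffT p hp).hasFDerivAt.sub L.hasFDerivAt
  have hMVT : ∀ p q : E × ℝ, ‖p‖ ≤ r → ‖q‖ ≤ r → ‖f q - f p‖ ≤ η * ‖q - p‖ := by
    intro p q hp hq
    refine (convex_closedBall (0 : E × ℝ) r).norm_image_sub_le_of_norm_hasFDerivWithin_le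
      (f := f) (fun z hz ↦ (hfderiv z (mem_closedBall_zero_iff.1 hz)).hasFDerivWithinAt)
      (fun z hz ↦ hDnear z (mem_closedBall_zero_iff.1 hz)) ?_ ?_
    · exact mem_closedBall_zero_iff.2 hp
    · exact mem_closedBall_zero_iff.2 hq
  have hf0 : f 0 = 0 := by simp [hf, hT0]
  have hfaxis : ∀ s : ℝ, |s| ≤ r → (f ((0 : E), s)).1 = 0 := fun s hs ↦ by
    simp [hf, hLapply, haxis s (lt_of_le_of_lt hs hrr₀)]
  -- the retraction
  set πE : E → E := fun x ↦ (r / max r ‖x‖) • x with hπE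
  set cl : ℝ → ℝ := fun t ↦ max (-r) (min r t) with hcl
  have hπE_id : ∀ x : E, ‖x‖ ≤ r → πE x = x := fun x hx ↦ by
    simp [hπE, max_eq_left hx, div_self hr.ne']
  have hπE_norm : ∀ x : E, ‖πE x‖ ≤ r := fun x ↦ by
    simp only [hπE, norm_smul, Real.norm_eq_abs, abs_div, abs_of_pos hr,
      abs_of_pos (lt_max_of_lt_left hr)]
    rcases le_or_gt ‖x‖ r with h | h
    · rw [max_eq_left h, div_self hr.ne', one_mul]; exact h
    · rw [max_eq_right h.le, div_mul_cancel₀ _ (by linarith)]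
  have hπE_cont : Continuous πE := by
    refine Continuous.smul (continuous_const.div (continuous_const.max continuous_norm)
      fun x ↦ (lt_max_of_lt_left hr).ne') continuous_id
  have hcl_id : ∀ t : ℝ, |t| ≤ r → cl t = t := fun t ht ↦ by
    simp [hcl, min_eq_right (abs_le.1 ht).2, max_eq_right (abs_le.1 ht).1]
  have hcl_mem : ∀ t : ℝ, cl t ∈ Icc (-r) r := fun t ↦
    ⟨le_max_left _ _, max_le (by linarith) (min_le_left _ _)⟩
  have hcl_abs : ∀ t : ℝ, |cl t| ≤ r := fun t ↦ abs_le.2 ⟨(hcl_mem t).1, (hcl_mem t).2⟩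
  have hcl_mono : Monotone cl := fun t t' h ↦ max_le_max le_rfl (min_le_min le_rfl h)
  have hcl_lip : ∀ t t' : ℝ, t ≤ t' → cl t' - cl t ≤ t' - t := by
    intro t t' h
    simp only [hcl]
    rcases le_total r t with h1 | h1 <;> rcases le_total r t' with h2 | h2 <;>
      simp only [min_eq_left, min_eq_right, h1, h2] <;>
      rcases le_total (-r) t with h3 | h3 <;> rcases le_total (-r) t' with h4 | h4 <;>
      simp only [max_eq_left, max_eq_right, h3, h4, le_refl, neg_le_self hr.le] <;> linarith
  have hcl_cont : Continuous cl := continuous_const.max (continuous_const.min continuous_id)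
  have hcl0 : cl 0 = 0 := hcl_id 0 (by simpa using hr.le)
  set π : E × ℝ → E × ℝ := fun p ↦ (πE p.1, cl p.2) with hπ
  have hπ_norm : ∀ p : E × ℝ, ‖π p‖ ≤ r := fun p ↦ by
    rw [Prod.norm_def]; exact max_le (hπE_norm _) (by simpa [Real.norm_eq_abs] using hcl_abs p.2)
  have hπ_id : ∀ p : E × ℝ, ‖p‖ ≤ r → π p = p := fun p hp ↦ by
    rw [Prod.norm_def, max_le_iff] at hp
    simp only [hπ, hπE_id p.1 hp.1, hcl_id p.2 (by simpa [Real.norm_eq_abs] using hp.2)]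
  -- the globalised map
  set T' : E × ℝ → E × ℝ := fun p ↦ L p + f (π p) with hT'
  have hT'1 : ∀ p : E × ℝ, (T' p).1 = S p.1 + (f (π p)).1 := fun p ↦ by
    simp [hT', hLapply]
  have hT'2 : ∀ p : E × ℝ, (T' p).2 = μ * p.2 + (f (π p)).2 := fun p ↦ by
    simp [hT', hLapply]
  have hπ_tube : ∀ p : E × ℝ, ‖p.1‖ ≤ r → π p = (p.1, cl p.2) := fun p hp ↦ by
    simp only [hπ, hπE_id p.1 hp]
  refine ⟨r, hr, hrr₀, T', ?_, ?_, ?_, ?_, ?_⟩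
  · -- continuity
    have hfc : ContinuousOn f (closedBall (0 : E × ℝ) r) :=
      (hTC1.continuousOn.mono fun p hp ↦ hballr p (mem_closedBall_zero_iff.1 hp)).sub
        L.continuous.continuousOn
    have hπc : Continuous π := by
      simp only [hπ]; exact (hπE_cont.comp continuous_fst).prodMk (hcl_cont.comp continuous_snd)
    exact L.continuous.add (hfc.comp_continuous hπc fun p ↦ mem_closedBall_zero_iff.2 (hπ_norm p))
  · -- agreement with `T` on the closed ball
    intro p hp
    simp only [hT', hπ_id p hp, hf]
    abel
  · -- (H1): `x`-contraction
    intro p hp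
    rw [hT'1, hπ_tube p hp]
    have h0 : (f ((0 : E), cl p.2)).1 = 0 := hfaxis _ (hcl_abs p.2)
    have hm := hMVT ((0 : E), cl p.2) (p.1, cl p.2) (by
      rw [Prod.norm_def]; simpa [Real.norm_eq_abs] using hcl_abs p.2)
      (by rw [Prod.norm_def]; exact max_le hp (by simpa [Real.norm_eq_abs] using hcl_abs p.2))
    have hdiff : ‖((p.1, cl p.2) : E × ℝ) - ((0 : E), cl p.2)‖ = ‖p.1‖ := by
      simp [Prod.norm_def]
    rw [hdiff] at hm
    have h1 : ‖(f (p.1, cl p.2)).1‖ ≤ η * ‖p.1‖ := by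
      have := norm_fst_le (f (p.1, cl p.2) - f ((0 : E), cl p.2))
      rw [Prod.fst_sub, h0, sub_zero] at this
      exact this.trans hm
    calc ‖S p.1 + (f (p.1, cl p.2)).1‖ ≤ ‖S p.1‖ + ‖(f (p.1, cl p.2)).1‖ := norm_add_le _ _
      _ ≤ ‖S‖ * ‖p.1‖ + η * ‖p.1‖ := add_le_add (S.le_opNorm _) h1
      _ = (‖S‖ + η) * ‖p.1‖ := by ring
  · -- (H3): axis defect
    intro x hx
    rw [hT'2, hπ_tube (x, 0) hx]
    simp only [mul_zero, zero_add, hcl0]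
    have hm := hMVT 0 (x, 0) (by simpa using hr.le) (by rw [Prod.norm_def]; simpa using hx)
    rw [hf0, sub_zero, sub_zero] at hm
    have := norm_snd_le (f (x, 0))
    rw [Real.norm_eq_abs] at this
    refine this.trans (hm.trans (le_of_eq ?_))
    simp [Prod.norm_def]
  · -- (H2): the cone condition on a thin tube
    intro κ hκ hκ1
    have hgap : 0 < μ - 2 * η - ‖S‖ := by linarith [norm_nonneg S]
    set ω₀ : ℝ := κ * (μ - 2 * η - ‖S‖) with hω₀
    have hω₀pos : 0 < ω₀ := mul_pos hκ hgap
    obtain ⟨ρ₁, hρ₁, hthin⟩ := exists_thin_tube hr₀ hrr₀ hTC1 hω₀pos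
    set ρ' : ℝ := min ρ₁ r with hρ'
    refine ⟨ρ', by positivity, min_le_right _ _, fun p q hp hq hpq hc ↦ ?_⟩
    have hpr : ‖p.1‖ ≤ r := hp.trans (min_le_right _ _)
    have hqr : ‖q.1‖ ≤ r := hq.trans (min_le_right _ _)
    have hp1 : ‖p.1‖ ≤ ρ₁ := hp.trans (min_le_left _ _)
    set Δ : ℝ := q.2 - p.2 with hΔ
    have hΔ0 : 0 ≤ Δ := sub_nonneg.2 hpq
    have hclΔ : cl q.2 - cl p.2 ≤ Δ := hcl_lip _ _ hpq
    have hclΔ0 : 0 ≤ cl q.2 - cl p.2 := sub_nonneg.2 (hcl_mono hpq)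
    -- the three increments of `f`
    have hnorm_pq : ‖((q.1, cl q.2) : E × ℝ) - (p.1, cl p.2)‖ ≤ Δ := by
      rw [Prod.norm_def]
      refine max_le (hc.trans ?_) ?_
      · exact (mul_le_of_le_one_left hΔ0 hκ1)
      · rw [Real.norm_eq_abs, Prod.snd_sub, abs_of_nonneg hclΔ0]; exact hclΔ
    have hmem_p : ‖((p.1, cl p.2) : E × ℝ)‖ ≤ r := by
      rw [Prod.norm_def]; exact max_le hpr (by simpa [Real.norm_eq_abs] using hcl_abs p.2)
    have hmem_q : ‖((q.1, cl q.2) : E × ℝ)‖ ≤ r := by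
      rw [Prod.norm_def]; exact max_le hqr (by simpa [Real.norm_eq_abs] using hcl_abs q.2)
    have hmem_m : ‖((p.1, cl q.2) : E × ℝ)‖ ≤ r := by
      rw [Prod.norm_def]; exact max_le hpr (by simpa [Real.norm_eq_abs] using hcl_abs q.2)
    -- total increment (for the second component)
    have htot := hMVT _ _ hmem_p hmem_q
    have h2nd : |(f (q.1, cl q.2)).2 - (f (p.1, cl p.2)).2| ≤ η * Δ := by
      have := norm_snd_le (f (q.1, cl q.2) - f (p.1, cl p.2))
      rw [Real.norm_eq_abs, Prod.snd_sub] at this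
      exact this.trans (htot.trans (mul_le_mul_of_nonneg_left hnorm_pq hη.le))
    -- horizontal increment (first component)
    have hhor : ‖(f (q.1, cl q.2)).1 - (f (p.1, cl q.2)).1‖ ≤ η * (κ * Δ) := by
      have hm := hMVT _ _ hmem_m hmem_q
      have hn : ‖((q.1, cl q.2) : E × ℝ) - (p.1, cl q.2)‖ = ‖q.1 - p.1‖ := by
        simp [Prod.norm_def]
      rw [hn] at hm
      have := norm_fst_le (f (q.1, cl q.2) - f (p.1, cl q.2))
      rw [Prod.fst_sub] at this
      exact this.trans (hm.trans (mul_le_mul_of_nonneg_left hc hη.le))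
    -- vertical increment (first component) on the thin tube
    have hver : ‖(f (p.1, cl q.2)).1 - (f (p.1, cl p.2)).1‖ ≤ ω₀ * Δ := by
      have hd : ∀ s ∈ Icc (-r) r, HasDerivWithinAt (fun u : ℝ ↦ (f (p.1, u)).1)
          (((fderiv ℝ T (p.1, s)) ((0 : E), (1 : ℝ))).1) (Icc (-r) r) s := by
        intro s hs
        have hps : ‖((p.1, s) : E × ℝ)‖ ≤ r := by
          rw [Prod.norm_def]
          exact max_le hpr (by rw [Real.norm_eq_abs]; exact abs_le.2 ⟨hs.1, hs.2⟩)
        have h1 : HasFDerivAt f (fderiv ℝ T (p.1, s) - L) (p.1, s) := hfderiv _ hps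
        have hc' : HasDerivAt (fun u : ℝ ↦ ((p.1, u) : E × ℝ)) ((0 : E), (1 : ℝ)) s :=
          (hasDerivAt_const s p.1).prodMk (hasDerivAt_id s)
        have h2 : HasDerivAt (fun u : ℝ ↦ (f (p.1, u)).1)
            (((fderiv ℝ T (p.1, s) - L) ((0 : E), (1 : ℝ))).1) s := (h1.comp_hasDerivAt s hc').fst
        have hval : ((fderiv ℝ T (p.1, s) - L) ((0 : E), (1 : ℝ))).1 =
            ((fderiv ℝ T (p.1, s)) ((0 : E), (1 : ℝ))).1 := by
          show ((fderiv ℝ T (p.1, s)) ((0 : E), (1 : ℝ)) - L ((0 : E), (1 : ℝ))).1 = _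
          rw [Prod.fst_sub, hLapply]
          simp
        rw [hval] at h2
        exact h2.hasDerivWithinAt
      have hbound : ∀ s ∈ Icc (-r) r, ‖((fderiv ℝ T (p.1, s)) ((0 : E), (1 : ℝ))).1‖ ≤ ω₀ := by
        intro s hs
        have hax : ((fderiv ℝ T ((0 : E), s)) ((0 : E), (1 : ℝ))).1 = 0 :=
          fderiv_vertical_fst_eq_zero hTC1 haxis (lt_of_le_of_lt (abs_le.2 ⟨hs.1, hs.2⟩) hrr₀)
        have hdiff : ((fderiv ℝ T (p.1, s)) ((0 : E), (1 : ℝ))).1 =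
            ((fderiv ℝ T (p.1, s) - fderiv ℝ T ((0 : E), s)) ((0 : E), (1 : ℝ))).1 := by
          show _ = ((fderiv ℝ T (p.1, s)) ((0 : E), (1 : ℝ)) -
            (fderiv ℝ T ((0 : E), s)) ((0 : E), (1 : ℝ))).1
          rw [Prod.fst_sub, hax, sub_zero]
        rw [hdiff]
        refine (norm_fst_le _).trans (((fderiv ℝ T (p.1, s) - fderiv ℝ T ((0 : E), s)).le_opNorm
          _).trans ?_)
        rw [show ‖((0 : E), (1 : ℝ))‖ = 1 by simp [Prod.norm_def], mul_one]
        exact (hthin p.1 s hp1 hs).le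
      have hm := (convex_Icc (-r) r).norm_image_sub_le_of_norm_hasDerivWithin_le hd hbound
        (hcl_mem p.2) (hcl_mem q.2)
      refine hm.trans ?_
      rw [Real.norm_eq_abs, abs_of_nonneg hclΔ0]
      exact mul_le_mul_of_nonneg_left hclΔ hω₀pos.le
    -- second component: expansion
    have hexp : (μ - η) * Δ ≤ (T' q).2 - (T' p).2 := by
      rw [hT'2, hT'2, hπ_tube p hpr, hπ_tube q hqr]
      have := (abs_le.1 h2nd).1
      nlinarith
    refine ⟨hexp, ?_⟩
    -- first component: cone invariance
    rw [hT'1, hT'1, hπ_tube p hpr, hπ_tube q hqr]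
    have hSb : ‖S q.1 - S p.1‖ ≤ ‖S‖ * (κ * Δ) := by
      rw [← map_sub]; exact (S.le_opNorm _).trans (mul_le_mul_of_nonneg_left hc (norm_nonneg _))
    have hsplit : S q.1 + (f (q.1, cl q.2)).1 - (S p.1 + (f (p.1, cl p.2)).1) =
        (S q.1 - S p.1) + ((f (q.1, cl q.2)).1 - (f (p.1, cl q.2)).1) +
          ((f (p.1, cl q.2)).1 - (f (p.1, cl p.2)).1) := by abel
    rw [hsplit]
    have htri : ‖(S q.1 - S p.1) + ((f (q.1, cl q.2)).1 - (f (p.1, cl q.2)).1) +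
        ((f (p.1, cl q.2)).1 - (f (p.1, cl p.2)).1)‖ ≤
        ‖S‖ * (κ * Δ) + η * (κ * Δ) + ω₀ * Δ :=
      (norm_add₃_le.trans (add_le_add (add_le_add hSb hhor) hver))
    refine htri.trans ?_
    have hkey : ‖S‖ * (κ * Δ) + η * (κ * Δ) + ω₀ * Δ = κ * ((μ - η) * Δ) := by
      simp only [hω₀]; ring
    rw [hkey]
    exact mul_le_mul_of_nonneg_left hexp hκ.le

end Summit.FinalStateConjecture.FinalStateConjecture.Theorems.LaminatedThreshold.Comb
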